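import Summits.ResolutionOfSingularities.ResolutionOfSingularities.Theorems.EquisingularLiftEquisingularLiftNatTangentConeFibre
import Summits.ResolutionOfSingularities.ResolutionOfSingularities.Theorems.EquisingularLiftEquisingularLiftNatInCarrierCentre
import Summits.ResolutionOfSingularities.ResolutionOfSingularities.Theorems.HilbertSamuelEliminationSigmaMaxModificationsCorridor3StrictTransformKernel
import Literature.AlgebraicGeometry.Resolution.BlowupReducedDimension
import Literature.AlgebraicGeometry.Resolution.StrictTransformDistinct
import Literature.AlgebraicGeometry.Resolution.MarkedIdealsArithmetic
import HarnessLib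

/-!
# [OURS · L1 W4.5(b) · EL♮(3)] K7a T-STCURVE — the strict transform of a VANISHING ideal sheaf is the vanishing ideal sheaf of the
# topological strict transform; `St(𝓢 ⊔ K) = St 𝓢 ⊔ St K` is decided at the stalks over the centre (crux `EquisingularLiftNatThree` =
# stmt-ResolutionOfSingularities-20148, parent stmt-20038; rung v7 (TC⁺), brick K7a of res-L1-w45b-stub-1's HSUB(ReachTC⁺)₃ assembly)

NOT a statement of any manuscript. Helper file of the chain res-L1-w45b (cell `res-hironaka`, rung L, slot W4.5(b)); AI-written, weaker than
expert review; filed `--supports stmt-ResolutionOfSingularities-20148 --as helper`; it closes nothing.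

WHERE IT SITS. res-L1-w45b-stub-1's BRICK DEAL 2026-08-27T11:31:42Z, row K7a (T-STCURVE, «downstairs exactness target» of `inv_step_regular`): after
the point step `υ₁ : G₂ → G` at a REGULAR point `y` of the running reduced curve `V(Zc)_red`, whose ideal is presented as `𝓢̄ ⊔ K̄ = 𝓘⟨Zc⟩`
(carrier divisor + cone), one needs `St(𝓢̄) ⊔ St(K̄) = 𝓘⟨closure υ₁⁻¹(Zc ∖ {y})⟩`. This file splits that into a FRAME-FREE part, proved here for
ANY blow-up along ANY centre, and the stalk identity over the centre, which is stub-1's `stalkIdeal_strictTransformIdeal_sup_eq_sup` (p522194) in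
its own cone-pack currency:

* **`strictTransformIdeal_vanishingIdeal_eq`** — for a blow-up `τ : X′ → X` along `J` (`X`, `X′` locally Noetherian) and ANY closed `Z ⊆ X`:
  `St_τ(𝓘⟨Z⟩) = 𝓘⟨closure τ⁻¹(Z ∖ supp J)⟩`. Proof: `V(St 𝓘⟨Z⟩) → V(Z)_red` is a blow-up (W4.2 `isBlowup_subscheme_strictTransformIdeal`,
  Görtz–Wedhorn 13.96 (2)) of a REDUCED scheme, hence reduced (`IsBlowup.isReduced_of_isReduced`); a reduced `V(K)` has `K = 𝓘(supp K)`
  (stub-1 `vanishingIdeal_support_eq_of_isReduced`, p508919); and `supp St(K) = closure τ⁻¹(supp K ∖ supp J)` (res-type-097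
  `support_strictTransformIdeal_eq_closure`).
* **`strictTransformIdeal_sup_eq_of_forall_stalkIdeal`** — `St(𝓢 ⊔ K) = St 𝓢 ⊔ St K` as soon as the STALKS agree at the points of the exceptional
  locus `supp τ*J` (off it all three are total transforms, `stalkIdeal_strictTransformIdeal_of_not_mem` + `Ideal.map_sup`).
* **`strictTransformIdeal_sup_eq_vanishingIdeal_of_forall_stalkIdeal`** — K7a ASSEMBLED: `𝓢 ⊔ K = 𝓘⟨Z⟩` + the stalk identity over the centre ⟹
  `St 𝓢 ⊔ St K = 𝓘⟨closure τ⁻¹(Z ∖ supp J)⟩`; `…_point` — the point-centre spelling `J = 𝓘⟨{y}⟩`, `Z ∖ {y}` of the registered text.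

References: U. Görtz, T. Wedhorn, *Algebraic Geometry I* (2020), (13.19), Prop. 13.91, 13.96 (2); The Stacks Project, Tag 080E — through the cited tree
files. OURS planning text (index only): res-L1-w45b-stub-1 STATUS 2026-08-27T11:31:42Z.
-/

set_option linter.dupNamespace false -- mandated namespace `Summit.<Summit>.<Problem>` of this single-conjunct summit

noncomputable section

open CategoryTheory AlgebraicGeometry TopologicalSpace Topology
open Literature.AlgebraicGeometry.Resolution AlgebraicGeometry.Scheme.IdealSheafData
open Summit.ResolutionOfSingularities.ResolutionOfSingularities.Theorems.SigmaMaxModificationsCorridor3.Helpers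

namespace Summit.ResolutionOfSingularities.ResolutionOfSingularities.Cruxes.EquisingularLiftNat.Sections

section StrictTransformVanishing

variable {X X' : Scheme.{0}} [IsLocallyNoetherian X] [IsLocallyNoetherian X'] (τ : X' ⟶ X) (J : X.IdealSheafData)

/-- **The strict transform of a vanishing ideal sheaf is a vanishing ideal sheaf.** For a blow-up `τ : X′ → X` along `J` and any closed
`Z ⊆ X`: `St_τ(𝓘⟨Z⟩) = 𝓘⟨closure τ⁻¹(Z ∖ supp J)⟩` — the schematic strict transform of the reduced closed subscheme on `Z` is the
reduced closed subscheme on the topological strict transform. [cite: GortzWedhorn2020, Prop. 13.96 (2) and (13.19)] [OURS · L1 W4.5b] -/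
theorem strictTransformIdeal_vanishingIdeal_eq (hτ : IsBlowup τ J) (Z : Set X) (hZ : IsClosed Z) :
    strictTransformIdeal τ J (vanishingIdeal (⟨Z, hZ⟩ : Closeds X)) =
      vanishingIdeal (⟨closure (τ ⁻¹' (Z \ (J.support : Set X))), isClosed_closure⟩ : Closeds X') := by
  set I := vanishingIdeal (⟨Z, hZ⟩ : Closeds X) with hI
  let i := I.subschemeι
  haveI : IsReduced I.subscheme := ComponentGluing.isReduced_subscheme_vanishingIdeal ⟨Z, hZ⟩
  haveI : IsLocallyNoetherian I.subscheme := LocallyOfFiniteType.isLocallyNoetherian i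
  have hker : i.ker = I := Scheme.IdealSheafData.ker_subschemeι I
  -- `V(St I) → V(Z)_red` is a blow-up, hence `V(St I)` is reduced
  obtain ⟨ρ, hρ⟩ := exists_hom_subscheme_strictTransformIdeal τ J i
  have hb : IsBlowup ρ (J.comap i) := isBlowup_subscheme_strictTransformIdeal hτ i ρ hρ
  haveI : IsReduced (strictTransformIdeal τ J i.ker).subscheme := hb.isReduced_of_isReduced
  have hred : vanishingIdeal (strictTransformIdeal τ J i.ker).support = strictTransformIdeal τ J i.ker :=
    vanishingIdeal_support_eq_of_isReduced _
  rw [hker] at hred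
  rw [← hred]
  congr 1
  apply Closeds.ext
  change ((strictTransformIdeal τ J I).support : Set X') = closure (τ ⁻¹' (Z \ (J.support : Set X)))
  rw [support_strictTransformIdeal_eq_closure τ J I, hI, Scheme.IdealSheafData.coe_support_vanishingIdeal]
  rfl

omit [IsLocallyNoetherian X] in
/-- **`St(𝓢 ⊔ K) = St 𝓢 ⊔ St K` is decided over the centre.** If the stalks of `St(𝓢 ⊔ K)` and of `St 𝓢 ⊔ St K` agree at every point of the
exceptional locus `supp τ*J`, the two ideal sheaves are equal (off the exceptional locus all three strict transforms are total transforms).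
[cite: GortzWedhorn2020, (13.19)] [OURS · L1 W4.5b] -/
theorem strictTransformIdeal_sup_eq_of_forall_stalkIdeal (𝓢 K : X.IdealSheafData)
    (hstalk : ∀ x' : X', x' ∈ ((J.comap τ).support : Set X') →
      stalkIdeal (strictTransformIdeal τ J (𝓢 ⊔ K)) x' =
        stalkIdeal (strictTransformIdeal τ J 𝓢) x' ⊔ stalkIdeal (strictTransformIdeal τ J K) x') :
    strictTransformIdeal τ J (𝓢 ⊔ K) = strictTransformIdeal τ J 𝓢 ⊔ strictTransformIdeal τ J K := by
  have hall : ∀ x' : X', stalkIdeal (strictTransformIdeal τ J (𝓢 ⊔ K)) x' =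
      stalkIdeal (strictTransformIdeal τ J 𝓢 ⊔ strictTransformIdeal τ J K) x' := by
    intro x'
    rw [stalkIdeal_sup]
    by_cases hx' : x' ∈ ((J.comap τ).support : Set X')
    · exact hstalk x' hx'
    · rw [stalkIdeal_strictTransformIdeal_of_not_mem τ J (𝓢 ⊔ K) hx', stalkIdeal_strictTransformIdeal_of_not_mem τ J 𝓢 hx',
        stalkIdeal_strictTransformIdeal_of_not_mem τ J K hx', stalkIdeal_sup, Ideal.map_sup]
  exact le_antisymm (le_of_forall_stalkIdeal_le fun x' => (hall x').le) (le_of_forall_stalkIdeal_le fun x' => (hall x').ge)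

/-- **K7a (T-STCURVE), assembled.** A blow-up `τ : X′ → X` along `J`, ideal sheaves `𝓢, K` with `𝓢 ⊔ K = 𝓘⟨Z⟩` for a closed `Z`, and the stalk
identity `St(𝓢 ⊔ K)_{x′} = St(𝓢)_{x′} + St(K)_{x′}` at the points `x′` of the exceptional locus (res-L1-w45b-stub-1's
`stalkIdeal_strictTransformIdeal_sup_eq_sup`, p522194, under the carrier cone pack) ⟹ `St 𝓢 ⊔ St K = 𝓘⟨closure τ⁻¹(Z ∖ supp J)⟩`.
[cite: GortzWedhorn2020, Prop. 13.96 (2)] [OURS · L1 W4.5b] -/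
theorem strictTransformIdeal_sup_eq_vanishingIdeal_of_forall_stalkIdeal (hτ : IsBlowup τ J) (𝓢 K : X.IdealSheafData)
    (Z : Set X) (hZ : IsClosed Z) (hZI : 𝓢 ⊔ K = vanishingIdeal (⟨Z, hZ⟩ : Closeds X))
    (hstalk : ∀ x' : X', x' ∈ ((J.comap τ).support : Set X') →
      stalkIdeal (strictTransformIdeal τ J (𝓢 ⊔ K)) x' =
        stalkIdeal (strictTransformIdeal τ J 𝓢) x' ⊔ stalkIdeal (strictTransformIdeal τ J K) x') :
    strictTransformIdeal τ J 𝓢 ⊔ strictTransformIdeal τ J K =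
      vanishingIdeal (⟨closure (τ ⁻¹' (Z \ (J.support : Set X))), isClosed_closure⟩ : Closeds X') := by
  rw [← strictTransformIdeal_sup_eq_of_forall_stalkIdeal τ J 𝓢 K hstalk, hZI]
  exact strictTransformIdeal_vanishingIdeal_eq τ J hτ Z hZ

/-- **K7a in the point-centre spelling of the registered text** (`J = 𝓘⟨{y}⟩`, `y` closed; `Z ∖ supp J = Z ∖ {y}`; the exceptional locus is
`τ⁻¹{y}`). [cite: GortzWedhorn2020, Prop. 13.96 (2)] [OURS · L1 W4.5b] -/
theorem strictTransformIdeal_sup_eq_vanishingIdeal_point {y : X} (hy : IsClosed ({y} : Set X))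
    (hτ : IsBlowup τ (vanishingIdeal ⟨{y}, hy⟩)) (𝓢 K : X.IdealSheafData)
    (Z : Set X) (hZ : IsClosed Z) (hZI : 𝓢 ⊔ K = vanishingIdeal (⟨Z, hZ⟩ : Closeds X))
    (hstalk : ∀ x' : X', τ x' = y →
      stalkIdeal (strictTransformIdeal τ (vanishingIdeal ⟨{y}, hy⟩) (𝓢 ⊔ K)) x' =
        stalkIdeal (strictTransformIdeal τ (vanishingIdeal ⟨{y}, hy⟩) 𝓢) x' ⊔
          stalkIdeal (strictTransformIdeal τ (vanishingIdeal ⟨{y}, hy⟩) K) x') :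
    strictTransformIdeal τ (vanishingIdeal ⟨{y}, hy⟩) 𝓢 ⊔ strictTransformIdeal τ (vanishingIdeal ⟨{y}, hy⟩) K =
      vanishingIdeal (⟨closure (τ ⁻¹' (Z \ {y})), isClosed_closure⟩ : Closeds X') := by
  have hsupp : ((vanishingIdeal (⟨{y}, hy⟩ : Closeds X)).support : Set X) = {y} := by
    rw [Scheme.IdealSheafData.coe_support_vanishingIdeal]; rfl
  have hstalk' : ∀ x' : X', x' ∈ (((vanishingIdeal (⟨{y}, hy⟩ : Closeds X)).comap τ).support : Set X') →
      stalkIdeal (strictTransformIdeal τ (vanishingIdeal ⟨{y}, hy⟩) (𝓢 ⊔ K)) x' =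
        stalkIdeal (strictTransformIdeal τ (vanishingIdeal ⟨{y}, hy⟩) 𝓢) x' ⊔
          stalkIdeal (strictTransformIdeal τ (vanishingIdeal ⟨{y}, hy⟩) K) x' := by
    intro x' hx'
    apply hstalk
    have h1 : τ x' ∈ ((vanishingIdeal (⟨{y}, hy⟩ : Closeds X)).support : Set X) := by
      rw [Scheme.IdealSheafData.support_comap] at hx'
      exact hx'
    rw [hsupp] at h1
    exact h1
  have h := strictTransformIdeal_sup_eq_vanishingIdeal_of_forall_stalkIdeal τ _ hτ 𝓢 K Z hZ hZI hstalk'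
  -- `Z ∖ supp 𝓘⟨{y}⟩` is `Z ∖ {y}` by definition of the support of a vanishing ideal sheaf
  rw [h]
  congr 1

end StrictTransformVanishing

/-! ## rev 2 (append-only): the stalk identity is only needed ON the strict transform of the carrier -/

section RevTwo

variable {X X' : Scheme.{0}} [IsLocallyNoetherian X] [IsLocallyNoetherian X'] (τ : X' ⟶ X) (J : X.IdealSheafData)

omit [IsLocallyNoetherian X] [IsLocallyNoetherian X'] in
/-- **The strict transform is monotone**: `K ≤ K′ ⇒ St K ≤ St K′`. [folklore] -/
theorem strictTransformIdeal_mono {K K' : X.IdealSheafData} (h : K ≤ K') :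
    strictTransformIdeal τ J K ≤ strictTransformIdeal τ J K' := by
  unfold strictTransformIdeal
  exact iSup_mono fun n => colon_mono_left (Scheme.IdealSheafData.comap_mono (f := τ) h) _

omit [IsLocallyNoetherian X] in
/-- **`St(𝓢 ⊔ K) = St 𝓢 ⊔ St K` is decided over the centre, ON the strict transform of `𝓢`** — the exact output shape of res-L1-w45b-stub-1's
`stalkIdeal_strictTransformIdeal_sup_eq_sup` (p522194, hypothesis `hx'S : x' ∈ supp St(𝓢)`): off `supp St(𝓢)` the stalk of `St 𝓢` is the unit ideal,
so both sides are `⊤` there (`St` is monotone). [cite: GortzWedhorn2020, (13.19)] [OURS · L1 W4.5b] -/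
theorem strictTransformIdeal_sup_eq_of_forall_stalkIdeal_of_mem_support (𝓢 K : X.IdealSheafData)
    (hstalk : ∀ x' : X', x' ∈ ((J.comap τ).support : Set X') → x' ∈ ((strictTransformIdeal τ J 𝓢).support : Set X') →
      stalkIdeal (strictTransformIdeal τ J (𝓢 ⊔ K)) x' =
        stalkIdeal (strictTransformIdeal τ J 𝓢) x' ⊔ stalkIdeal (strictTransformIdeal τ J K) x') :
    strictTransformIdeal τ J (𝓢 ⊔ K) = strictTransformIdeal τ J 𝓢 ⊔ strictTransformIdeal τ J K := by
  refine strictTransformIdeal_sup_eq_of_forall_stalkIdeal τ J 𝓢 K fun x' hx' => ?_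
  by_cases hS : x' ∈ ((strictTransformIdeal τ J 𝓢).support : Set X')
  · exact hstalk x' hx' hS
  · have htop : stalkIdeal (strictTransformIdeal τ J 𝓢) x' = ⊤ := stalkIdeal_eq_top_of_not_mem_support hS
    have hle : stalkIdeal (strictTransformIdeal τ J 𝓢) x' ≤ stalkIdeal (strictTransformIdeal τ J (𝓢 ⊔ K)) x' :=
      stalkIdeal_mono (strictTransformIdeal_mono τ J le_sup_left) x'
    rw [htop] at hle ⊢
    rw [top_le_iff.mp hle, top_sup_eq]

/-- **K7a (T-STCURVE) with the stalk identity asked only on `supp St(𝓢)` over the centre** (point-centre spelling `J = 𝓘⟨{y}⟩`).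
[cite: GortzWedhorn2020, Prop. 13.96 (2)] [OURS · L1 W4.5b] -/
theorem strictTransformIdeal_sup_eq_vanishingIdeal_point_of_mem_support {y : X} (hy : IsClosed ({y} : Set X))
    (hτ : IsBlowup τ (vanishingIdeal ⟨{y}, hy⟩)) (𝓢 K : X.IdealSheafData)
    (Z : Set X) (hZ : IsClosed Z) (hZI : 𝓢 ⊔ K = vanishingIdeal (⟨Z, hZ⟩ : Closeds X))
    (hstalk : ∀ x' : X', τ x' = y → x' ∈ ((strictTransformIdeal τ (vanishingIdeal ⟨{y}, hy⟩) 𝓢).support : Set X') →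
      stalkIdeal (strictTransformIdeal τ (vanishingIdeal ⟨{y}, hy⟩) (𝓢 ⊔ K)) x' =
        stalkIdeal (strictTransformIdeal τ (vanishingIdeal ⟨{y}, hy⟩) 𝓢) x' ⊔
          stalkIdeal (strictTransformIdeal τ (vanishingIdeal ⟨{y}, hy⟩) K) x') :
    strictTransformIdeal τ (vanishingIdeal ⟨{y}, hy⟩) 𝓢 ⊔ strictTransformIdeal τ (vanishingIdeal ⟨{y}, hy⟩) K =
      vanishingIdeal (⟨closure (τ ⁻¹' (Z \ {y})), isClosed_closure⟩ : Closeds X') := by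
  have hsupp : ((vanishingIdeal (⟨{y}, hy⟩ : Closeds X)).support : Set X) = {y} := by
    rw [Scheme.IdealSheafData.coe_support_vanishingIdeal]; rfl
  have heq := strictTransformIdeal_sup_eq_of_forall_stalkIdeal_of_mem_support τ (vanishingIdeal ⟨{y}, hy⟩) 𝓢 K
    (fun x' hx' hS => by
      apply hstalk x' _ hS
      have h1 : τ x' ∈ ((vanishingIdeal (⟨{y}, hy⟩ : Closeds X)).support : Set X) := by
        rw [Scheme.IdealSheafData.support_comap] at hx'
        exact hx'
      rw [hsupp] at h1
      exact h1)
  rw [← heq, hZI, strictTransformIdeal_vanishingIdeal_eq τ _ hτ Z hZ]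
  congr 1

end RevTwo

end Summit.ResolutionOfSingularities.ResolutionOfSingularities.Cruxes.EquisingularLiftNat.Sections

end
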